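import Literature.NumberTheory.DiophantineApproximation.DilogHermitePade
import Mathlib.Analysis.SpecificLimits.Basic
import HarnessLib

/-!
# Type-I Hermite–Padé forms for `1, Li₁, Li₂`: vanishing, positivity and size of the kernel

Topic `Literature/NumberTheory/DiophantineApproximation`. Elementary facts about the kernel
`R_n(t) = ∏_{j=1}^{2n} (t − j) / ∏_{i=0}^{n} (t + i)²` (`DilogPade.kernel`) and the form
`S_n(x) = ∑_{t ≥ 1} R_n(t) x^t` (`DilogPade.form`) of the sibling vocabulary file
`DilogHermitePade.lean` (David–Hirata-Kohno–Kawashima 2020, Thm 2.1; Nikišin 1979; Hata 1990):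

* `num_natCast_eq_zero`, `kernel_natCast_eq_zero` — the numerator, hence the kernel, vanishes at
  the integers `t = 1, …, 2n` (the factor `j = t − 1` of `∏_{j<2n} (t − (j+1))` is zero);
* `den_pos`, `kernel_natCast_pos`, `kernel_natCast_nonneg`, `kernel_natCast_le_one`,
  `abs_kernel_succ_le_one` — for integers `t ≥ 2n + 1` every factor of the numerator lies in
  `(0, t]`, so `0 < num ≤ t^{2n} ≤ t^{2n+2} ≤ den`, whence `0 < R_n(t) ≤ 1`; together with the
  vanishing, `0 ≤ R_n(t) ≤ 1` for every integer `t ≥ 1`;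
* `kernel_two_mul_add_one` — the first nonzero coefficient
  `R_n(2n+1) = (2n)! / ((2n+1)(2n+2)⋯(3n+1))² = (2n)!³ / ((3n+1)!)²`;
* `summable_form`, `form_pos`, `form_le_div`, `form_le`, `form_ge` — for `0 ≤ x < 1` the series
  converges (comparison with the geometric series), `0 < S_n(x)` for `0 < x`,
  `S_n(x) ≤ x^{2n+1}/(1 − x)` (only the terms `t ≥ 2n+1` survive and `R_n(t) ≤ 1`), hence
  `S_n(x) ≤ x^{2n}` for `x ≤ 1/2`, and `S_n(x) ≥ R_n(2n+1) x^{2n+1} = (2n)!³/((3n+1)!)² · x^{2n+1}`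
  (all terms are nonnegative).

These are the "analytic half" of the linear independence argument for
`1, Li₁(1/N), Li₂(1/N)`: with `x = 1/N` they give `0 < S_n(1/N) ≤ N^{−2n}`. Everything is proved
from Mathlib; no definitions, no named facts.
-/

noncomputable section

open Finset

namespace Literature.NumberTheory.DiophantineApproximation.DilogPade

/-! ## The numerator and the denominator at positive integers -/

/-- The numerator `∏_{j=1}^{2n} (t − j)` vanishes at the integers `t = 1, …, 2n`.
[cite: DavidHirataKohnoKawashima2020, Thm 2.1] -/
theorem num_natCast_eq_zero {n t : ℕ} (ht : 1 ≤ t) (ht' : t ≤ 2 * n) : num n (t : ℝ) = 0 := by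
  unfold num
  refine Finset.prod_eq_zero (i := t - 1) (Finset.mem_range.2 (by omega)) ?_
  have h : ((t - 1 : ℕ) : ℝ) + 1 = t := by
    rw [Nat.cast_sub ht]
    push_cast
    ring
  rw [h, sub_self]

/-- The denominator `∏_{i=0}^{n} (t + i)²` is positive for `t > 0`. [folklore] -/
theorem den_pos {n : ℕ} {t : ℝ} (ht : 0 < t) : 0 < den n t :=
  Finset.prod_pos fun i _ => by positivity

/-- For an integer `t ≥ 2n + 1` the numerator `∏_{j=1}^{2n} (t − j)` is positive (every factor is).
[cite: DavidHirataKohnoKawashima2020, Thm 2.1] -/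
theorem num_natCast_pos {n t : ℕ} (ht : 2 * n + 1 ≤ t) : 0 < num n (t : ℝ) := by
  unfold num
  refine Finset.prod_pos fun j hj => ?_
  have hj' : j + 1 < t := by have := Finset.mem_range.1 hj; omega
  have h : (j : ℝ) + 1 < t := by exact_mod_cast hj'
  exact sub_pos.2 h

/-- For an integer `t ≥ 2n + 1` the numerator satisfies `∏_{j=1}^{2n} (t − j) ≤ t^{2n}`
(every factor lies in `[0, t]`). [cite: DavidHirataKohnoKawashima2020, Thm 2.1] -/
theorem num_natCast_le_pow {n t : ℕ} (ht : 2 * n + 1 ≤ t) : num n (t : ℝ) ≤ (t : ℝ) ^ (2 * n) := by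
  unfold num
  calc ∏ j ∈ range (2 * n), ((t : ℝ) - ((j : ℝ) + 1))
      ≤ ∏ _j ∈ range (2 * n), (t : ℝ) := by
        refine Finset.prod_le_prod (fun j hj => ?_) (fun j _ => ?_)
        · have hj' : j + 1 < t := by have := Finset.mem_range.1 hj; omega
          have h : (j : ℝ) + 1 < t := by exact_mod_cast hj'
          exact (sub_pos.2 h).le
        · linarith [(j.cast_nonneg : (0 : ℝ) ≤ j)]
    _ = (t : ℝ) ^ (2 * n) := by rw [Finset.prod_const, Finset.card_range]

/-- For real `t ≥ 1` the denominator dominates: `t^{2n} ≤ t^{2n+2} ≤ ∏_{i=0}^{n} (t + i)²`.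
[folklore] -/
theorem pow_le_den (n : ℕ) {t : ℝ} (ht : 1 ≤ t) : t ^ (2 * n) ≤ den n t := by
  unfold den
  have ht0 : 0 ≤ t := zero_le_one.trans ht
  calc t ^ (2 * n) ≤ t ^ (2 * (n + 1)) := pow_le_pow_right₀ ht (by omega)
    _ = ∏ _i ∈ range (n + 1), t ^ 2 := by rw [Finset.prod_const, Finset.card_range, ← pow_mul]
    _ ≤ ∏ i ∈ range (n + 1), (t + (i : ℝ)) ^ 2 :=
        Finset.prod_le_prod (fun i _ => pow_nonneg ht0 2) fun i _ =>
          pow_le_pow_left₀ ht0 (by linarith [(i.cast_nonneg : (0 : ℝ) ≤ i)]) 2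

/-! ## The kernel at positive integers -/

/-- The kernel `R_n(t)` vanishes at the integers `t = 1, …, 2n`: the series `S_n(x)` starts at
`x^{2n+1}`. [cite: DavidHirataKohnoKawashima2020, Thm 2.1] -/
theorem kernel_natCast_eq_zero {n t : ℕ} (ht : 1 ≤ t) (ht' : t ≤ 2 * n) :
    kernel n (t : ℝ) = 0 := by
  rw [kernel, num_natCast_eq_zero ht ht', zero_div]

/-- The kernel `R_n(t)` is positive at the integers `t ≥ 2n + 1`.
[cite: DavidHirataKohnoKawashima2020, Thm 2.1] -/
theorem kernel_natCast_pos {n t : ℕ} (ht : 2 * n + 1 ≤ t) : 0 < kernel n (t : ℝ) := by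
  unfold kernel
  have ht0 : (0 : ℝ) < t := by exact_mod_cast (by omega : 0 < t)
  exact div_pos (num_natCast_pos ht) (den_pos ht0)

/-- The kernel `R_n(t)` is nonnegative at every integer `t ≥ 1`.
[cite: DavidHirataKohnoKawashima2020, Thm 2.1] -/
theorem kernel_natCast_nonneg {n t : ℕ} (ht : 1 ≤ t) : 0 ≤ kernel n (t : ℝ) := by
  rcases le_or_gt t (2 * n) with h | h
  · rw [kernel_natCast_eq_zero ht h]
  · exact (kernel_natCast_pos h).le

/-- The kernel satisfies `R_n(t) ≤ 1` at every integer `t ≥ 1`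
(`0 ≤ num ≤ t^{2n} ≤ den` for `t ≥ 2n+1`, and `R_n(t) = 0` for `t ≤ 2n`).
[cite: DavidHirataKohnoKawashima2020, Thm 2.1] -/
theorem kernel_natCast_le_one {n t : ℕ} (ht : 1 ≤ t) : kernel n (t : ℝ) ≤ 1 := by
  rcases le_or_gt t (2 * n) with h | h
  · rw [kernel_natCast_eq_zero ht h]
    exact zero_le_one
  · have ht1 : (1 : ℝ) ≤ t := by exact_mod_cast ht
    unfold kernel
    exact div_le_one_of_le₀ ((num_natCast_le_pow h).trans (pow_le_den n ht1))
      (den_pos (zero_lt_one.trans_le ht1)).le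

/-- The kernel vanishes at `t + 1` for `t < 2n` (index shift of `kernel_natCast_eq_zero`, in the
indexing of `form`). [cite: DavidHirataKohnoKawashima2020, Thm 2.1] -/
theorem kernel_succ_eq_zero {n t : ℕ} (ht : t < 2 * n) : kernel n ((t : ℝ) + 1) = 0 := by
  have h := kernel_natCast_eq_zero (n := n) (t := t + 1) (by omega) (by omega)
  rwa [Nat.cast_add_one] at h

/-- The kernel is positive at `t + 1` for `t ≥ 2n` (index shift of `kernel_natCast_pos`).
[cite: DavidHirataKohnoKawashima2020, Thm 2.1] -/
theorem kernel_succ_pos {n t : ℕ} (ht : 2 * n ≤ t) : 0 < kernel n ((t : ℝ) + 1) := by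
  have h := kernel_natCast_pos (n := n) (t := t + 1) (by omega)
  rwa [Nat.cast_add_one] at h

/-- The kernel is nonnegative at `t + 1` for every `t : ℕ` (index shift of
`kernel_natCast_nonneg`). [cite: DavidHirataKohnoKawashima2020, Thm 2.1] -/
theorem kernel_succ_nonneg (n t : ℕ) : 0 ≤ kernel n ((t : ℝ) + 1) := by
  have h := kernel_natCast_nonneg (n := n) (t := t + 1) (by omega)
  rwa [Nat.cast_add_one] at h

/-- The kernel is at most `1` at `t + 1` for every `t : ℕ` (index shift of
`kernel_natCast_le_one`). [cite: DavidHirataKohnoKawashima2020, Thm 2.1] -/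
theorem kernel_succ_le_one (n t : ℕ) : kernel n ((t : ℝ) + 1) ≤ 1 := by
  have h := kernel_natCast_le_one (n := n) (t := t + 1) (by omega)
  rwa [Nat.cast_add_one] at h

/-- `|R_n(t + 1)| ≤ 1` for every `t : ℕ`: the coefficients of `S_n` are bounded by `1`, so the
series converges absolutely for `|x| < 1`. [cite: DavidHirataKohnoKawashima2020, Thm 2.1] -/
theorem abs_kernel_succ_le_one (n t : ℕ) : |kernel n ((t : ℝ) + 1)| ≤ 1 := by
  rw [abs_of_nonneg (kernel_succ_nonneg n t)]
  exact kernel_succ_le_one n t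

/-! ## The first nonzero coefficient -/

/-- `∏_{j<m} (m − j) = m!` (over `ℝ`). [folklore] -/
theorem prod_range_natCast_sub (m : ℕ) :
    ∏ j ∈ range m, ((m : ℝ) - (j : ℝ)) = (m.factorial : ℝ) := by
  induction m with
  | zero => simp
  | succ m ih =>
    rw [Finset.prod_range_succ', Nat.factorial_succ, Nat.cast_mul, ← ih]
    have h : ∀ j ∈ range m, ((m + 1 : ℕ) : ℝ) - ((j + 1 : ℕ) : ℝ) = (m : ℝ) - j := by
      intro j _
      push_cast
      ring
    rw [Finset.prod_congr rfl h]
    push_cast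
    ring

/-- `(2n)! · ∏_{i=0}^{n} (2n + 1 + i) = (3n + 1)!` (over `ℝ`; Mathlib's
`Nat.factorial_mul_ascFactorial`). [folklore] -/
theorem factorial_mul_prod_range_eq (n : ℕ) :
    ((2 * n).factorial : ℝ) * ∏ i ∈ range (n + 1), (((2 * n : ℕ) : ℝ) + 1 + (i : ℝ)) =
      ((3 * n + 1).factorial : ℝ) := by
  have h := Nat.factorial_mul_ascFactorial (2 * n) (n + 1)
  rw [Nat.ascFactorial_eq_prod_range, show 2 * n + (n + 1) = 3 * n + 1 by ring] at h
  exact_mod_cast h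

/-- The numerator at `t = 2n + 1` is `∏_{j=1}^{2n} (2n + 1 − j) = (2n)!`.
[cite: DavidHirataKohnoKawashima2020, Thm 2.1] -/
theorem num_two_mul_add_one (n : ℕ) :
    num n ((2 * n : ℕ) + 1 : ℝ) = ((2 * n).factorial : ℝ) := by
  rw [num, ← prod_range_natCast_sub (2 * n)]
  exact Finset.prod_congr rfl fun j _ => by ring

/-- The denominator at `t = 2n + 1` is `(∏_{i=0}^{n} (2n + 1 + i))²`.
[cite: DavidHirataKohnoKawashima2020, Thm 2.1] -/
theorem den_two_mul_add_one (n : ℕ) :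
    den n ((2 * n : ℕ) + 1 : ℝ) = (∏ i ∈ range (n + 1), (((2 * n : ℕ) : ℝ) + 1 + (i : ℝ))) ^ 2 := by
  rw [den, Finset.prod_pow]

/-- **The first nonzero coefficient of `S_n`**:
`R_n(2n + 1) = (2n)! / ((2n+1)(2n+2)⋯(3n+1))² = (2n)!³ / ((3n+1)!)²`.
[cite: DavidHirataKohnoKawashima2020, Thm 2.1] -/
theorem kernel_two_mul_add_one (n : ℕ) :
    kernel n ((2 * n : ℕ) + 1 : ℝ) =
      ((2 * n).factorial : ℝ) ^ 3 / (((3 * n + 1).factorial : ℝ) ^ 2) := by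
  have hP : 0 < ∏ i ∈ range (n + 1), (((2 * n : ℕ) : ℝ) + 1 + (i : ℝ)) :=
    Finset.prod_pos fun i _ => by positivity
  have hf : (0 : ℝ) < (2 * n).factorial := by exact_mod_cast Nat.factorial_pos _
  rw [kernel, num_two_mul_add_one, den_two_mul_add_one, ← factorial_mul_prod_range_eq n,
    div_eq_div_iff (pow_ne_zero _ hP.ne') (pow_ne_zero _ (mul_ne_zero hf.ne' hP.ne'))]
  ring

/-! ## Convergence and the two-sided bounds for `S_n(x)` -/

/-- For `0 ≤ x < 1` the series `S_n(x) = ∑_{t ≥ 1} R_n(t) x^t` converges (its terms lie between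
`0` and those of the geometric series). [cite: DavidHirataKohnoKawashima2020, Thm 2.1] -/
theorem summable_form (n : ℕ) {x : ℝ} (hx : 0 ≤ x) (hx1 : x < 1) :
    Summable fun t : ℕ => kernel n ((t : ℝ) + 1) * x ^ (t + 1) := by
  have hg : Summable fun t : ℕ => x ^ (t + 1) := by
    simp_rw [pow_succ]
    exact (summable_geometric_of_lt_one hx hx1).mul_right x
  refine Summable.of_nonneg_of_le (fun t => ?_) (fun t => ?_) hg
  · exact mul_nonneg (kernel_succ_nonneg n t) (pow_nonneg hx _)
  · exact mul_le_of_le_one_left (pow_nonneg hx _) (kernel_succ_le_one n t)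

/-- **Positivity**: `0 < S_n(x)` for `0 < x < 1` (all terms are `≥ 0` and the term `t = 2n + 1`
is `> 0`). [cite: DavidHirataKohnoKawashima2020, Thm 2.1] -/
theorem form_pos (n : ℕ) {x : ℝ} (hx : 0 < x) (hx1 : x < 1) : 0 < form n x := by
  unfold form
  exact (summable_form n hx.le hx1).tsum_pos
    (fun t => mul_nonneg (kernel_succ_nonneg n t) (pow_nonneg hx.le _)) (2 * n)
    (mul_pos (kernel_succ_pos le_rfl) (pow_pos hx _))

/-- **Tail bound**: `S_n(x) ≤ x^{2n+1} / (1 − x)` for `0 ≤ x < 1` (the terms `t ≤ 2n` vanish and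
`0 ≤ R_n(t) ≤ 1` for the others, so `S_n(x) ≤ ∑_{t ≥ 2n+1} x^t`).
[cite: DavidHirataKohnoKawashima2020, Thm 2.1] -/
theorem form_le_div (n : ℕ) {x : ℝ} (hx : 0 ≤ x) (hx1 : x < 1) :
    form n x ≤ x ^ (2 * n + 1) / (1 - x) := by
  have hs := summable_form n hx hx1
  have h0 : ∑ t ∈ range (2 * n), kernel n ((t : ℝ) + 1) * x ^ (t + 1) = 0 :=
    Finset.sum_eq_zero fun t ht => by rw [kernel_succ_eq_zero (Finset.mem_range.1 ht), zero_mul]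
  have hs' : Summable fun t : ℕ => kernel n (((t + 2 * n : ℕ) : ℝ) + 1) * x ^ (t + 2 * n + 1) :=
    (summable_nat_add_iff (f := fun t : ℕ => kernel n ((t : ℝ) + 1) * x ^ (t + 1)) (2 * n)).2 hs
  have hg : Summable fun t : ℕ => x ^ (2 * n + 1) * x ^ t :=
    (summable_geometric_of_lt_one hx hx1).mul_left _
  unfold form
  rw [← hs.sum_add_tsum_nat_add (2 * n), h0, zero_add]
  calc ∑' t : ℕ, kernel n (((t + 2 * n : ℕ) : ℝ) + 1) * x ^ (t + 2 * n + 1)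
      ≤ ∑' t : ℕ, x ^ (2 * n + 1) * x ^ t := by
        refine hs'.tsum_le_tsum (fun t => ?_) hg
        calc kernel n (((t + 2 * n : ℕ) : ℝ) + 1) * x ^ (t + 2 * n + 1)
            ≤ x ^ (t + 2 * n + 1) :=
              mul_le_of_le_one_left (pow_nonneg hx _) (kernel_succ_le_one n (t + 2 * n))
          _ = x ^ (2 * n + 1) * x ^ t := by rw [← pow_add]; congr 1; ring
    _ = x ^ (2 * n + 1) / (1 - x) := by
        rw [tsum_mul_left, tsum_geometric_of_lt_one hx hx1, div_eq_mul_inv]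

/-- **Upper bound**: `S_n(x) ≤ x^{2n}` for `n ≥ 1` and `0 ≤ x ≤ 1/2`
(`S_n(x) ≤ x^{2n+1}/(1 − x) ≤ x^{2n}` as `x ≤ 1 − x`); at `x = 1/N`, `N ≥ 2`, this is
`S_n(1/N) ≤ N^{−2n}`. (The hypothesis `1 ≤ n`, the range in which the bound is used, is not
needed by the proof.) [cite: DavidHirataKohnoKawashima2020, Thm 2.1] -/
theorem form_le {n : ℕ} (_hn : 1 ≤ n) {x : ℝ} (hx : 0 ≤ x) (hx1 : x ≤ 1 / 2) :
    form n x ≤ x ^ (2 * n) := by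
  have hx1' : x < 1 := by linarith
  refine (form_le_div n hx hx1').trans ?_
  rw [div_le_iff₀ (by linarith), pow_succ]
  exact mul_le_mul_of_nonneg_left (by linarith) (pow_nonneg hx _)

/-- **Lower bound**: `S_n(x) ≥ R_n(2n+1) x^{2n+1} = (2n)!³/((3n+1)!)² · x^{2n+1}` for
`0 ≤ x < 1` (all terms are nonnegative; keep the first nonzero one).
[cite: DavidHirataKohnoKawashima2020, Thm 2.1] -/
theorem form_ge (n : ℕ) {x : ℝ} (hx : 0 ≤ x) (hx1 : x < 1) :
    ((2 * n).factorial : ℝ) ^ 3 / (((3 * n + 1).factorial : ℝ) ^ 2) * x ^ (2 * n + 1) ≤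
      form n x := by
  rw [form, ← kernel_two_mul_add_one]
  exact (summable_form n hx hx1).le_tsum (2 * n) fun t _ =>
    mul_nonneg (kernel_succ_nonneg n t) (pow_nonneg hx _)

end Literature.NumberTheory.DiophantineApproximation.DilogPade
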